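import Summits.QuantumFields.YangMills.Theorems.BalabanUVNodesN18CombStepC0Sum
import Summits.QuantumFields.YangMills.Theorems.BalabanUVNodesN18TransportedPairGcValuedAllBonds
import HarnessLib

/-!
# N18 (β)-transport letters: THE COMB GENERATOR OF RECORD AND ITS C⁰ LETTERS AT THE TABLE (`tr l = 0`, `|l| ≤ ξδ₀`, `|∇l| ≤ ξδ₁`, `|A′_A − i∇l| ≤ S₀`, crude C¹)

[DAGN18W3-G5 INTENT-3] — count-neutral helper toward K3⁸ `stmt-QuantumFields-27366` (K3⁷ `stmt-QuantumFields-20544` aside; NOT claimed, NOT closed).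
YM mass gap (Clay) NOT proved by any of this; R4 closes the conditional finite-𝕋⁴ rung `BalabanLadder.UV` only.

WHAT.  Per table point `(j, Y, Φ)` of FILE 7 ∕ G (p607192 ∕ p619718), for run B's factorisation `Φ.U = (exp iηA′)·U` with (i) at `α₀B` and (ii) at `α₁B` on run B's frame
over `bmap⁻¹(domSites Y)` (`η = η_{j+1}` of run B, `ξ = η_j` of run A, `ξ = Lη`), THE COMB GENERATOR OF RECORD on run A's unit lattice
`l(x) := iη·λ̄_{Ad(axialT U (emb x̂))A′_X}(x̂)`, `x̂ = siteShift x ∈ T^{(1)}_{k+1}`, `A′_X = A′` on the frame's bonds and `0` off them (so that `l` is traceless EVERYWHERE),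
and its letters in the exact shapes of G's `hrest`:
* `comb_trace` (`tr l(x) = 0` for all `x`), `comb_norm_le` (`‖l(x)‖ ≤ η·ℓ·α₁B` on `domSites Y`, `ℓ = (d+2)L`; i.e. `δ₀ = (d+2)·α₁B`),
  `comb_nabla_le` (`‖∇^ξ_{U_A} l‖ ≤ 2ηℓα₁B∕ξ` on `domSites Y`'s unit steps — CRUDE), ★★★ `comb_cancelled_C0_le` (`‖A′_A(b) − i∇^ξ_{U_A} l(b)‖ ≤ S₀` on the frame's bonds,
  `S₀ = α₁B + R∕ξ + 69ℓ²tα₁B∕L`, `t = (ℓ∕2)·α₀B·η²` — file (2b) ★★ at `c = bondShift b` + the dictionary `TΦ.U b = Ū(Φ.U)(c)`, `U_A b = Ū(U)(c)`,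
  `∇^ξ_{fieldShift Ū} (l̂ ∘ siteShift) = (∇^ξ_{Ū} l̂) ∘ siteShift`), `comb_cancelled_C1_crude_le` (`≤ 2S₀∕ξ` on the frame's direction pairs — CRUDE; the C¹ main-term
  cancellation is the successor's M3).
Displayed numerics: `ηα₁B ≤ 1∕4`, `136ℓ((2ηα₁B + t + 2ηα₁B·t) + t) ≤ 1`, two-block guards of FILE D.

0 `def`, 0 `sorry`.  References: T. Bałaban, CMP **98** (1985) [Balaban1985Averaging] ((62)–(63) p.28, Prop. 3 (122)–(126) p.36, p.24); CMP **109** (1987) [Balaban1987RG1]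
((0.4) p.253, (0.24)–(0.25) p.257, (1.10)–(1.16) p.262).
-/

noncomputable section

open scoped BigOperators Matrix.Norms.L2Operator
open NormedSpace

namespace YMDAG.N18.TransportOfRecord

open Complex (I)
open Literature.MathematicalPhysics.QuantumFieldTheory.Balaban1983to89
open Literature.MathematicalPhysics.QuantumFieldTheory.Balaban1983to89.T4Continuum
open Literature.MathematicalPhysics.QuantumFieldTheory.Balaban1983to89.T4LevelShift
open Literature.MathematicalPhysics.QuantumFieldTheory.Balaban1983to89.BlockAveraging
open Literature.MathematicalPhysics.QuantumFieldTheory.Balaban1983to89.BlockAveragingEMLLinearised (walkSum walkSum_nil walkSum_cons combMean combMean_def)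
open Literature.MathematicalPhysics.QuantumFieldTheory.Balaban1983to89.B12RegularSpaces111
open Literature.MathematicalPhysics.QuantumFieldTheory.Balaban1983to89.B12RegularSpaces111SpecialUnitary (suModel mem_suModel_G mem_suModel_gc suModel_norm_le)
open Literature.MathematicalPhysics.QuantumFieldTheory.Balaban1983to89.MatrixLog (mlog)
open Literature.MathematicalPhysics.QuantumFieldTheory.Balaban1983to89.B7Prop1Explicit (U1 mem_U1)
open Literature.MathematicalPhysics.QuantumFieldTheory.Balaban1983to89.B10Eq27TorusAxialLog (axialT axialT_self)
open Literature.MathematicalPhysics.QuantumFieldTheory.Balaban1983to89.T4TermwiseBCH (norm_units_conj_le)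
open Literature.MathematicalPhysics.QuantumFieldTheory.Balaban1983to89.Node00 (MatA)
open Literature.MathematicalPhysics.QuantumFieldTheory.Balaban1983to89.Node00.Sect2 (regionOfSet domSys domSites frameI Residual)
open Literature.MathematicalPhysics.QuantumFieldTheory.Balaban1983to89.Node00.W1
open YMDAG.N18.AvgPotential (combMean_congr_block twoBlocks_subset_bonds_preimage)
open YMDAG.N18.TwoRunCubes (ladder domSites_pairOfRecord_eq_preimage)

/-! ## §1 Small generic letters: traces through the comb, `∇` through the level identification, the crude `∇` -/

section Small

variable {P : Params} {j : ℕ} {n : Type*} [Fintype n]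

/-- A signed walk sum of traceless bond letters is traceless. [cite: Balaban1985Averaging, (62) p.28 (linearity)] -/
theorem trace_walkSum_eq_zero {Y : PBond P j → Matrix n n ℂ} (hY : ∀ b, Matrix.trace (Y b) = 0) :
    ∀ γ : List (LStep P j), Matrix.trace (walkSum Y γ) = 0
  | [] => by simp
  | s :: γ => by
    rw [walkSum_cons, Matrix.trace_add, trace_walkSum_eq_zero hY γ, add_zero]
    split_ifs
    · exact hY _
    · rw [Matrix.trace_neg, hY, neg_zero]

/-- The comb mean of traceless bond letters is traceless. [cite: Balaban1985Averaging, (62) p.28 (linearity)] -/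
theorem trace_combMean_eq_zero {Y : PBond P j → Matrix n n ℂ} (hY : ∀ b, Matrix.trace (Y b) = 0) (y : Site P (j + 1)) :
    Matrix.trace (combMean Y y) = 0 := by
  rw [combMean_def, Matrix.trace_smul, Matrix.trace_sum]
  simp only [trace_walkSum_eq_zero hY, Finset.sum_const_zero, smul_zero]

/-- `Ad(u)` preserves tracelessness bondwise. [cite: Balaban1987RG1, (1.10) p.262] -/
theorem trace_adJ_eq_zero [DecidableEq n] (u : Site P j → (Matrix n n ℂ)ˣ) {Y : PBond P j → Matrix n n ℂ} (hY : ∀ b, Matrix.trace (Y b) = 0) (b : PBond P j) :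
    Matrix.trace (adJ u Y b) = 0 := by
  unfold adJ; rw [Matrix.trace_units_conj, hY]

/-- The CRUDE covariant-derivative bound for an arbitrary site function: `‖∇^ξ_{U,μ}F(x)‖ ≤ (‖F(x + e_μ)‖ + ‖F(x)‖)∕ξ` for a bi-contractive transporter.
[cite: Balaban1987RG1, (1.13) p.262] -/
theorem norm_nabla_le_add_div [DecidableEq n] [Nonempty n] {i : ℕ} {ξ : ℝ} (hξ : 0 < ξ) {U : PBond P i → (Matrix n n ℂ)ˣ} (F : Site P i → Matrix n n ℂ) (x : Site P i) (μ : Fin P.d)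
    (hU : U ⟨x, μ⟩ ∈ U1 (Matrix n n ℂ)) : ‖nabla ξ U μ F x‖ ≤ (‖F (x.shift μ)‖ + ‖F x‖) / ξ := by
  unfold nabla
  rw [norm_smul, norm_inv, Complex.norm_real, Real.norm_of_nonneg hξ.le, le_div_iff₀ hξ, mul_comm, ← mul_assoc, mul_inv_cancel₀ hξ.ne', one_mul]
  exact (norm_sub_le _ _).trans (add_le_add (norm_units_conj_le hU _) le_rfl)

end Small

/-! ## §2 The record: the comb generator of record and its letters at the table -/

section Record

variable (F : T4Family) (N : ℕ) [NeZero N] (M k : ℕ)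

omit [NeZero N] in
/-- `∇^ξ` through the level identification: for a coarse function read on run A's unit lattice, `∇^ξ_{fieldShift V}(l̂ ∘ siteShift)(x) = ∇^ξ_V l̂ (siteShift x)`.
[cite: Balaban1987RG1, (0.1) p.251, (1.13) p.262 (bookkeeping)] -/
theorem nabla_fieldShift_comp (ξ : ℝ) (V : PBond (F.P (k + 1)) 1 → (MatA N)ˣ) (μ : Fin 4) (lh : Site (F.P (k + 1)) 1 → MatA N) (x : Site (F.P k) 0) :
    nabla ξ (fieldShift (ladder F k) V) μ (fun y => lh (siteShift (ladder F k) y)) x = nabla ξ V μ lh (siteShift (ladder F k) x) := by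
  unfold nabla
  dsimp only
  rw [fieldShift_apply, siteShift_shift]
  rfl

variable {F N M k}

/-- ★★★ **THE COMB GENERATOR OF RECORD AND ITS C⁰ LETTERS AT THE TABLE.**  Per table point `(j, Y)` and run-B data `Φ.U = (exp iηA′)·U` (`Factors`), (i) at `α₀B`, (ii) at
`α₁B` on run B's frame over `bmap⁻¹(domSites Y)`: with `A′_X := χ_{X.bonds}·A′`, `l̂(ŷ) := iη·λ̄_{Ad(axialT U (emb ŷ))A′_X}(ŷ)`, `l := l̂ ∘ siteShift`, `U_A := fieldShift (Ū U)`,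
`Pot(b) := (iξ)⁻¹ log(TΦ.U(b)·U_A(b)⁻¹)`, `ℓ = (d+2)L`, `t ≥ (ℓ∕2)·α₀B·η²`, and `S₀ := (η∕ξ)·L·α₁B + R(ηα₁B, t)∕ξ + (η∕ξ)·69ℓ²·t·α₁B` (p624650's `R`),
there is `l` (exhibited: (0) `l = l̂ ∘ siteShift` pointwise, the formula displayed) with (1) `tr l(x) = 0` for every `x`; (2) `‖l(x)‖ ≤ η·ℓ·α₁B` on `domSites Y`; (3) `‖∇^ξ_{U_A,μ} l(x)‖ ≤ 2ηℓα₁B∕ξ` on `domSites Y`'s unit steps (crude);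
(4) `‖Pot(b) − i∇^ξ_{U_A} l(b)‖ ≤ S₀` on the frame's bonds; (5) `‖∇^ξ_{U_A,ν}(Pot(⟨·,μ⟩) − i∇^ξ_{U_A,μ} l)(x)‖ ≤ 2S₀∕ξ` on the frame's direction pairs (crude).
Displayed numerics: `ηα₁B ≤ 1∕4`, `136ℓ((2ηα₁B + t + 2ηα₁B·t) + t) ≤ 1`. [cite: Balaban1985Averaging, (62)-(63) p.28, Prop. 3 (122)-(126) p.36; Balaban1987RG1, (0.4) p.253, (0.24)-(0.25) p.257, (1.10)-(1.16) p.262] -/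
theorem comb_letters_TΦOfRecord (Rz : Residual (F.P (k + 1)) (MatA N)) (j : ℕ) (Y : (domSys (F.P k) M j).Dom)
    [DecidablePred (· ∈ (frameI Rz M (j + 1) (domSites (F.P (k + 1)) M (j + 1) (pairOfRecord F M k ⟨j, Y⟩).2)).X.bonds)] {cB : StepConsts} {α₀B α₁B : ℝ}
    {Φ : FieldPair (F.P (k + 1)) 0 (MatA N)ˣ (MatA N)} {U : PBond (F.P (k + 1)) 0 → (MatA N)ˣ} {A' : PBond (F.P (k + 1)) 0 → MatA N}
    (hcBξ : cB.ξ = (F.P (k + 1)).eta (j + 1))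
    (hf : Factors cB Φ.U U A')
    (hI : CondI (suModel N) (frameI Rz M (j + 1) (domSites (F.P (k + 1)) M (j + 1) (pairOfRecord F M k ⟨j, Y⟩).2)) cB α₀B U)
    (hII : CondII (suModel N) (frameI Rz M (j + 1) (domSites (F.P (k + 1)) M (j + 1) (pairOfRecord F M k ⟨j, Y⟩).2)).X cB α₁B U A')
    (hα0 : 0 ≤ α₀B) (hα1 : 0 ≤ α₁B) (hξ₁ : (F.P (k + 1)).eta (j + 1) * α₁B ≤ 1 / 4) {t : ℝ}
    (hRt : (((((F.P (k + 1)).d + 2) * (F.P (k + 1)).L : ℕ) : ℝ) / 2) * (α₀B * (F.P (k + 1)).eta (j + 1) ^ 2) ≤ t)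
    (hℓ : 136 * (((((F.P (k + 1)).d + 2) * (F.P (k + 1)).L : ℕ) : ℝ)) *
      ((2 * ((F.P (k + 1)).eta (j + 1) * α₁B) + t + 2 * ((F.P (k + 1)).eta (j + 1) * α₁B) * t) + t) ≤ 1)
    -- FILE 7's guard making `Ū(U)(c)` unitary on the frame bonds (`avgUnits_factor_mem_suModel_G`)
    (hUA1 : ∀ b ∈ (frameI (Residual.unit (F.P k) (MatA N)) M j (domSites (F.P k) M j Y)).X.bonds,
      fieldShift (ladder F k) (avgUnits U) b ∈ U1 (MatA N)) :
    let X := (frameI Rz M (j + 1) (domSites (F.P (k + 1)) M (j + 1) (pairOfRecord F M k ⟨j, Y⟩).2)).X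
    let AX : PBond (F.P (k + 1)) 0 → MatA N := fun b => if b ∈ X.bonds then A' b else 0
    let UA : PBond (F.P k) 0 → (MatA N)ˣ := fieldShift (ladder F k) (avgUnits U)
    let S₀ : ℝ := (F.P (k + 1)).eta (j + 1) / (F.P k).eta j * (((F.P (k + 1)).L : ℝ) * α₁B) +
      (4 * (34 * (((((F.P (k + 1)).d + 2) * (F.P (k + 1)).L : ℕ) : ℝ)) * ((2 * ((F.P (k + 1)).eta (j + 1) * α₁B) + t + 2 * ((F.P (k + 1)).eta (j + 1) * α₁B) * t) + t)) ^ 2 +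
        578 * (((((F.P (k + 1)).d + 2) * (F.P (k + 1)).L : ℕ) : ℝ)) ^ 2 * ((2 * ((F.P (k + 1)).eta (j + 1) * α₁B) + t + 2 * ((F.P (k + 1)).eta (j + 1) * α₁B) * t) + t) * t +
        660 * (((((F.P (k + 1)).d + 2) * (F.P (k + 1)).L : ℕ) : ℝ)) ^ 2 * ((2 * ((F.P (k + 1)).eta (j + 1) * α₁B) + t + 2 * ((F.P (k + 1)).eta (j + 1) * α₁B) * t) ^ 2 + t ^ 2) +
        3 * (((((F.P (k + 1)).d + 2) * (F.P (k + 1)).L : ℕ) : ℝ)) * (2 * ((F.P (k + 1)).eta (j + 1) * α₁B) * t) +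
        3 * (((((F.P (k + 1)).d + 2) * (F.P (k + 1)).L : ℕ) : ℝ)) * ((F.P (k + 1)).eta (j + 1) * α₁B) ^ 2) / (F.P k).eta j +
      (F.P (k + 1)).eta (j + 1) / (F.P k).eta j * (69 * (((((F.P (k + 1)).d + 2) * (F.P (k + 1)).L : ℕ) : ℝ)) ^ 2 * t * α₁B)
    ∃ l : Site (F.P k) 0 → MatA N,
    (∀ x, l x = (I * ((F.P (k + 1)).eta (j + 1) : ℂ)) • combMean (adJ (axialT U (emb (siteShift (ladder F k) x))) AX) (siteShift (ladder F k) x)) ∧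
    (∀ x, Matrix.trace (l x) = 0) ∧
    (∀ x ∈ domSites (F.P k) M j Y, ‖l x‖ ≤ (F.P (k + 1)).eta (j + 1) * ((((((F.P (k + 1)).d + 2) * (F.P (k + 1)).L : ℕ) : ℝ)) * α₁B)) ∧
    (∀ (x : Site (F.P k) 0) (μ : Fin (F.P k).d), x ∈ domSites (F.P k) M j Y → x.shift μ ∈ domSites (F.P k) M j Y →
      ‖nabla ((F.P k).eta j) UA μ l x‖ ≤ 2 * ((F.P (k + 1)).eta (j + 1) * ((((((F.P (k + 1)).d + 2) * (F.P (k + 1)).L : ℕ) : ℝ)) * α₁B)) / (F.P k).eta j) ∧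
    (∀ b ∈ (frameI (Residual.unit (F.P k) (MatA N)) M j (domSites (F.P k) M j Y)).X.bonds,
      ‖(I * ((F.P k).eta j : ℂ))⁻¹ • mlog ((((TΦOfRecord F N k Φ).U b : (MatA N)ˣ) : MatA N) * (((UA b)⁻¹ : (MatA N)ˣ) : MatA N)) -
        I • nabla ((F.P k).eta j) UA b.dir l b.src‖ ≤ S₀) ∧
    (∀ q ∈ (frameI (Residual.unit (F.P k) (MatA N)) M j (domSites (F.P k) M j Y)).X.dpairs,
      ‖nabla ((F.P k).eta j) UA q.2.1
          (fun y => (I * ((F.P k).eta j : ℂ))⁻¹ • mlog ((((TΦOfRecord F N k Φ).U ⟨y, q.2.2⟩ : (MatA N)ˣ) : MatA N) * (((UA ⟨y, q.2.2⟩)⁻¹ : (MatA N)ˣ) : MatA N)) -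
            I • nabla ((F.P k).eta j) UA q.2.2 l y) q.1‖ ≤ 2 * S₀ / (F.P k).eta j) := by
  intro X AX UA S₀
  -- the comb generator of record
  let lh : Site (F.P (k + 1)) 1 → MatA N := fun y => (I * ((F.P (k + 1)).eta (j + 1) : ℂ)) • combMean (adJ (axialT U (emb y)) AX) y
  let l : Site (F.P k) 0 → MatA N := fun x => lh (siteShift (ladder F k) x)
  -- abbreviations and positivity
  set η : ℝ := (F.P (k + 1)).eta (j + 1) with hηdef
  set ξ : ℝ := (F.P k).eta j with hξdef
  set ℓ : ℝ := (((((F.P (k + 1)).d + 2) * (F.P (k + 1)).L : ℕ) : ℝ)) with hℓdef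
  have hη : 0 < η := pow_pos (inv_pos.mpr (Nat.cast_pos.mpr (F.P (k + 1)).L_pos)) _
  have hξ : 0 < ξ := pow_pos (inv_pos.mpr (Nat.cast_pos.mpr (F.P k).L_pos)) _
  have hℓ0 : 0 ≤ ℓ := Nat.cast_nonneg _
  have hj1 : 0 + 1 ≤ (F.P (k + 1)).m + (F.P (k + 1)).K := by simp only [T4Family.P_m, T4Family.P_K]; omega
  have hj2 : 0 + 2 ≤ (F.P (k + 1)).m + (F.P (k + 1)).K := by simp only [T4Family.P_m, T4Family.P_K]; have := F.hm; omega
  -- run B's region is the block preimage of `domSites Y`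
  have hX : X = regionOfSet (F.P (k + 1)) ((fun x => (siteShift (ladder F k)).symm (blockOf x)) ⁻¹' domSites (F.P k) M j Y) := by
    show regionOfSet (F.P (k + 1)) (domSites (F.P (k + 1)) M (j + 1) (pairOfRecord F M k ⟨j, Y⟩).2) = _
    rw [domSites_pairOfRecord_eq_preimage]
  -- the cut-off potential: traceless and bounded EVERYWHERE, `= A′` on the frame's bonds
  have hAXtr : ∀ b, Matrix.trace (AX b) = 0 := fun b => by
    by_cases hb : b ∈ X.bonds
    · simp only [AX, if_pos hb]; exact mem_suModel_gc.mp (hII.gcValued b hb)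
    · simp only [AX, if_neg hb, Matrix.trace_zero]
  have hAXle : ∀ b, ‖AX b‖ ≤ α₁B := fun b => by
    by_cases hb : b ∈ X.bonds
    · simp only [AX, if_pos hb]; exact (hII.norm_lt b hb).le
    · simp only [AX, if_neg hb, norm_zero]; exact hα1
  have hAXeq : ∀ b ∈ X.bonds, AX b = A' b := fun b hb => by simp only [AX, if_pos hb]
  -- block bonds of a site of `domSites Y` ∕ two-block bonds and plaquettes of a frame bond are in run B's region
  have hblk : ∀ x ∈ domSites (F.P k) M j Y, ∀ b : PBond (F.P (k + 1)) 0, blockOf b.src = siteShift (ladder F k) x → blockOf b.tgt = siteShift (ladder F k) x →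
      b ∈ X.bonds := fun x hx b h1 h2 => by
    rw [hX]
    refine ⟨?_, ?_⟩
    · show (siteShift (ladder F k)).symm (blockOf b.src) ∈ domSites (F.P k) M j Y
      rw [h1, Equiv.symm_apply_apply]; exact hx
    · show (siteShift (ladder F k)).symm (blockOf b.tgt) ∈ domSites (F.P k) M j Y
      rw [h2, Equiv.symm_apply_apply]; exact hx
  have htwo : ∀ b ∈ (frameI (Residual.unit (F.P k) (MatA N)) M j (domSites (F.P k) M j Y)).X.bonds, ∀ b' : PBond (F.P (k + 1)) 0,
      (blockOf b'.src = (bondShift (ladder F k) b).src ∨ blockOf b'.src = (bondShift (ladder F k) b).tgt) →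
      (blockOf b'.tgt = (bondShift (ladder F k) b).src ∨ blockOf b'.tgt = (bondShift (ladder F k) b).tgt) → b' ∈ X.bonds := fun b hb b' h1 h2 => by
    rw [hX]; obtain ⟨y, μ⟩ := b; exact twoBlocks_subset_bonds_preimage F k _ hb b' h1 h2
  have htwop : ∀ b ∈ (frameI (Residual.unit (F.P k) (MatA N)) M j (domSites (F.P k) M j Y)).X.bonds, ∀ p : Plaq (F.P (k + 1)) 0,
      (blockOf p.src = (bondShift (ladder F k) b).src ∨ blockOf p.src = (bondShift (ladder F k) b).tgt) →
      (blockOf (p.src.shift p.μ) = (bondShift (ladder F k) b).src ∨ blockOf (p.src.shift p.μ) = (bondShift (ladder F k) b).tgt) →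
      (blockOf (p.src.shift p.ν) = (bondShift (ladder F k) b).src ∨ blockOf (p.src.shift p.ν) = (bondShift (ladder F k) b).tgt) →
      (blockOf ((p.src.shift p.μ).shift p.ν) = (bondShift (ladder F k) b).src ∨ blockOf ((p.src.shift p.μ).shift p.ν) = (bondShift (ladder F k) b).tgt) →
      p ∈ X.plaqs := fun b hb p h1 h2 h3 h4 => by
    rw [hX]; obtain ⟨y, μ⟩ := b; exact twoBlocks_subset_plaqs_preimage _ hb p h1 h2 h3 h4
  -- (2) the size of the comb generator on `domSites Y`
  have hlh : ∀ x ∈ domSites (F.P k) M j Y, ‖lh (siteShift (ladder F k) x)‖ ≤ η * (ℓ * α₁B) := fun x hx => by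
    set ŷ := siteShift (ladder F k) x with hŷ
    -- cut the adjoint potential off to the block, where the block's axial gauge is bi-contractive
    let U' : GaugeField (F.P (k + 1)) 0 (MatA N)ˣ := fun b => if blockOf b.src = ŷ ∧ blockOf b.tgt = ŷ then U b else 1
    have hU'1 : ∀ b, U' b ∈ U1 (MatA N) := fun b => by
      by_cases hb : blockOf b.src = ŷ ∧ blockOf b.tgt = ŷ
      · simp only [U', if_pos hb]
        have hG := hI.gValued b (hblk x hx b hb.1 hb.2)
        exact mem_U1.mpr ⟨suModel_norm_le _ hG, suModel_norm_le _ ((suModel N).G.inv_mem hG)⟩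
      · simp only [U', if_neg hb]; exact (U1 _).one_mem
    let Yb : PBond (F.P (k + 1)) 0 → MatA N := fun b => if blockOf b.src = ŷ ∧ blockOf b.tgt = ŷ then adJ (axialT U (emb ŷ)) AX b else 0
    have hYb : ∀ b, ‖Yb b‖ ≤ α₁B := fun b => by
      by_cases hb : blockOf b.src = ŷ ∧ blockOf b.tgt = ŷ
      · simp only [Yb, if_pos hb, adJ]
        have hu : axialT U (emb ŷ) b.src ∈ U1 (MatA N) := by
          rw [axialT_congr_of_block hj1 (V' := U') (fun b' h1 h2 => by simp only [U', if_pos (And.intro h1 h2)]) hb.1]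
          exact axialT_mem_U1 hU'1 _ _
        exact (norm_units_conj_le hu _).trans (hAXle b)
      · simp only [Yb, if_neg hb, norm_zero]; exact hα1
    have hcm : combMean (adJ (axialT U (emb ŷ)) AX) ŷ = combMean Yb ŷ :=
      combMean_congr_block hj1 ŷ fun b h1 h2 => by simp only [Yb, if_pos (And.intro h1 h2)]
    show ‖(I * (η : ℂ)) • combMean (adJ (axialT U (emb ŷ)) AX) ŷ‖ ≤ η * (ℓ * α₁B)
    rw [hcm, norm_smul, norm_mul, Complex.norm_I, one_mul, Complex.norm_real, Real.norm_of_nonneg hη.le]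
    exact mul_le_mul_of_nonneg_left (norm_combMean_le_of_bound Yb hα1 hYb ŷ) hη.le
  -- (4) the C⁰ cancelled sum at a frame bond: file (2b) ★★ at `c = bondShift b`
  have h4 : ∀ b ∈ (frameI (Residual.unit (F.P k) (MatA N)) M j (domSites (F.P k) M j Y)).X.bonds,
      ‖(I * ((F.P k).eta j : ℂ))⁻¹ • mlog ((((TΦOfRecord F N k Φ).U b : (MatA N)ˣ) : MatA N) * (((UA b)⁻¹ : (MatA N)ˣ) : MatA N)) -
        I • nabla ((F.P k).eta j) UA b.dir l b.src‖ ≤ S₀ := fun b hb => by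
    set c : PBond (F.P (k + 1)) 1 := bondShift (ladder F k) b with hc
    have h2b := norm_potential_add_transported_comb_le hj1 hj2 c (Uc := Φ.U) (U := U) (A := AX) (η := η) (ξ := ξ) (a := α₁B)
      (α := α₀B * η ^ 2) (t := t) hη.le hξ hα1 (by positivity)
      (fun b' h1 h2 => by rw [hAXeq b' (htwo b hb b' h1 h2), ← hcBξ]; exact hf b') (fun b' _ _ => hAXle b') (by linarith)
      (fun b' h1 h2 => by
        have hG := hI.gValued b' (htwo b hb b' h1 h2)
        exact mem_U1.mpr ⟨suModel_norm_le _ hG, suModel_norm_le _ ((suModel N).G.inv_mem hG)⟩)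
      (fun p h1 h2 h3 h4 => by rw [← hcBξ]; exact (hI.plaq_lt p (htwop b hb p h1 h2 h3 h4)).le) hRt hℓ
    -- the dictionary: `TΦ.U b = Ū(Φ.U)(c)`, `UA b = Ū(U)(c)`, `c.src = ŝrc`, `c.tgt = siteShift b.tgt`, `I•∇l = −(η/ξ)•(…)`
    have hTU : (TΦOfRecord F N k Φ).U b = avgUnits Φ.U c := by rw [TΦOfRecord_U]
    have hUAb : UA b = avgUnits U c := rfl
    have hUAb' : UA ⟨b.src, b.dir⟩ = avgUnits U c := rfl
    have hsrc : c.src = siteShift (ladder F k) b.src := rfl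
    have htgt : c.tgt = siteShift (ladder F k) (b.src.shift b.dir) := bondShift_tgt _ _
    have hnab : I • nabla ξ UA b.dir l b.src =
        -(((η / ξ : ℝ) : ℂ) • (((avgUnits U c : (MatA N)ˣ) : MatA N) * combMean (adJ (axialT U (emb c.tgt)) AX) c.tgt *
          (((avgUnits U c)⁻¹ : (MatA N)ˣ) : MatA N) - combMean (adJ (axialT U (emb c.src)) AX) c.src)) := by
      show I • ((ξ : ℂ)⁻¹ • (((UA ⟨b.src, b.dir⟩ : (MatA N)ˣ) : MatA N) * lh (siteShift (ladder F k) (b.src.shift b.dir)) *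
          (((UA ⟨b.src, b.dir⟩)⁻¹ : (MatA N)ˣ) : MatA N) - lh (siteShift (ladder F k) b.src))) = _
      rw [hUAb', ← htgt, ← hsrc]
      show I • ((ξ : ℂ)⁻¹ • (((avgUnits U c : (MatA N)ˣ) : MatA N) * ((I * (η : ℂ)) • combMean (adJ (axialT U (emb c.tgt)) AX) c.tgt) *
          (((avgUnits U c)⁻¹ : (MatA N)ˣ) : MatA N) - (I * (η : ℂ)) • combMean (adJ (axialT U (emb c.src)) AX) c.src)) = _
      rw [mul_smul_comm, smul_mul_assoc, ← smul_sub, smul_smul, smul_smul, ← neg_smul]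
      congr 1
      have hI2 : I * I = -1 := Complex.I_mul_I
      push_cast
      rw [div_eq_mul_inv]
      linear_combination ((η : ℂ) * (ξ : ℂ)⁻¹) * hI2
    rw [hTU, hUAb, hnab, sub_neg_eq_add]
    exact h2b
  refine ⟨l, fun x => rfl, fun x => ?_, fun x hx => hlh x hx, fun x μ hx hxμ => ?_, h4, fun q hq => ?_⟩
  · -- (1) traceless everywhere
    show Matrix.trace ((I * (η : ℂ)) • combMean (adJ (axialT U (emb (siteShift (ladder F k) x))) AX) (siteShift (ladder F k) x)) = 0
    rw [Matrix.trace_smul, trace_combMean_eq_zero (trace_adJ_eq_zero _ hAXtr), smul_zero]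
  · -- (3) crude `∇l`
    have hU : UA ⟨x, μ⟩ ∈ U1 (MatA N) := hUA1 ⟨x, μ⟩ ⟨hx, hxμ⟩
    refine (norm_nabla_le_add_div hξ l x μ hU).trans (div_le_div_of_nonneg_right ?_ hξ.le)
    have h1 := hlh x hx
    have h2 := hlh (x.shift μ) hxμ
    show ‖lh (siteShift (ladder F k) (x.shift μ))‖ + ‖lh (siteShift (ladder F k) x)‖ ≤ 2 * (η * (ℓ * α₁B))
    linarith
  · -- (5) the crude C¹ letter: both bonds `⟨x, μ'⟩`, `⟨x + e_ν', μ'⟩` are frame bonds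
    obtain ⟨h0, hμ, hν, hμν⟩ := hq
    have hU : UA ⟨q.1, q.2.1⟩ ∈ U1 (MatA N) := hUA1 ⟨q.1, q.2.1⟩ ⟨h0, hμ⟩
    refine (norm_nabla_le_add_div hξ _ q.1 q.2.1 hU).trans (div_le_div_of_nonneg_right ?_ hξ.le)
    have ha := h4 ⟨q.1, q.2.2⟩ ⟨h0, hν⟩
    have hb := h4 ⟨q.1.shift q.2.1, q.2.2⟩ ⟨hμ, hμν⟩
    dsimp only at ha hb ⊢
    linarith

end Record

end YMDAG.N18.TransportOfRecord

end
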